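import Summits.HodgeConjecture.HodgeConjecture.Theorems.MarkmanPartnerTransportK3Sq2TranscendentalPresentationHK
import Summits.HodgeConjecture.HodgeConjecture.Theorems.MarkmanPartnerTransportPicardThreeK3SquaresKugaSatakeSelfClassMap
import Summits.HodgeConjecture.HodgeConjecture.Theorems.MarkmanPartnerTransportPicardThreeK3SquaresKugaSatakeSelfPresentation

/-!
# Route MarkmanPartnerTransport · crux `LowPicardRealMultiplication` (stmt-HodgeConjecture-19653) —
# programme «KS-SELF-X», step 1: Hodge descent of a rational self-map of `H²` of a marked `K3^{[2]}`-type
# fourfold to `T(X)_ℚ`, the SECOND PRESENTATION `(T, d·P, j ∘ θ_T)`, and the two Kuga–Satake correspondences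

The `K3^{[2]}`-side twin of gen 14's `…KugaSatakeSelfPresentation` + `…KugaSatakeSelfClassMap` §4, written
against the hyperkähler records `IsTranscendentalPartHK` / `IsKSCorrespondenceAlgebraicHK` (Floccari 2024 §5.1)
and this seat's presentation of `T(X)_ℚ` (`…K3Sq2BettiTwoHodgeStructure`, `…K3Sq2TranscendentalPresentationHK`).
Target of the programme: the X-side self-similitude theorem — `θ` rational, type-preserving, `q`-self-adjoint
with `q`-transcendental image and `θ² = d` on `T(X)` is cycle-induced on `T(X)` GRANTED `IsKSCorrespondenceAlgebraicHK 2`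
and Charles–Markman's `B(X)` — i.e. the hypothesis `hVar = Varesco2023_…_of_lefschetzStandard` of
`OrphanKSCore.exists_algebraicCorrespondence_eq_on_bbfTransc_of_kugaSatake` DISCHARGED for marked `K3^{[2]}`-type `X`.

* §1 `exists_hom_ofRatClass_eqHK` — a rational, type-preserving `θ : H²(X(ℂ); ℂ) → H²(X(ℂ); ℂ)` is the
  complexification of a morphism of `ℚ`-Hodge structures `Θ_B : H²_B(X) → H²_B(X)`.
* §2 `map_hodgeClassesHK_baseChange_eq` (`Θ(Hdg¹_ℂ) = N¹(X) = algebraicClasses X 1`, Lefschetz `(1,1)`),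
  `bbfTransc_iff_hodgeClasses` (`q`-orthogonality to `N¹(X)` ⟺ to the rational Hodge classes).
* §3 `exists_hom_transcendentalHK` — restriction `θ_T : Hom T T` to the transcendental part
  `T = Hdg¹^{⊥ q_B}` when `θ` has `q`-transcendental image; `hom_transcendentalHK_sq` (`θ_T² = d`),
  `bbf_hom_transcendentalHK` (`q`-self-adjointness descends).
* §4 `isTranscendentalPartHK_smul_comp` — for ANY `2n`-dimensional `X`: if `(T, H, P, j)` presents the
  transcendental part (`IsTranscendentalPartHK`, Fujiki form `b`) and `g : Hom H H` is `b`-self-adjoint with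
  `g² = d > 0`, then `(T, H, d·P, j ∘ g)` presents it too (Varesco's "`ψ` induces a similitude of multiplier
  `λ`" read as a change of presentation).
* §5 `exists_two_correspondences_of_kugaSatakeHK` — GRANTED `IsKSCorrespondenceAlgebraicHK n` for `X`: ONE
  Kuga–Satake variety `A` (vG §5–8 + Riemann's theorem, `exists_isKugaSatakeVarietyBetti_of_isOfK3Type'`), an
  injective class map `μ : T → H²((A × A)(ℂ); ℚ)` and two maps `O₁, O₂ : H²(X) → H²(A × A)` INDUCED BY ALGEBRAIC
  CYCLES with `O₁(j t ⊗ 1) = μ t ⊗ 1 = O₂(j (g t) ⊗ 1)` — the predicate instantiated at both presentations,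
  the Clifford data transported along `C⁺(dQ) ≅ C⁺(Q)` (gen 14's `…KugaSatakeSimilarTransport` / `…SelfClassMap` §3).

THEOREMS ONLY; no definition, no new named fact, no sorry; nothing here says HC, the crux or Kuga–Satake is
proved. Prover seat hodge-nonav-19652-p1 (gen 15), `--supports stmt-HodgeConjecture-19653`.

References: M. Varesco, Math. Z. 305 (2023) §4 (proof of Thm. 4.5), Cor. 4.6; S. Floccari, arXiv:2210.02948
§5.1; B. van Geemen, *Kuga–Satake varieties and the Hodge conjecture* (2000) §5–6, §10; C. Voisin, *Hodge
Theory I* §7.1.1, §7.3.1, Thm. 11.30; D. Huybrechts, *Lectures on K3 Surfaces* Ch. 3 Lemma 3.1.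
-/

set_option linter.dupNamespace false

noncomputable section

namespace Summit.HodgeConjecture.HodgeConjecture.Theorems.MarkmanPartnerTransport.KugaSatakeHK

open scoped TensorProduct
open CategoryTheory Literature.AlgebraicGeometry Literature.AlgebraicGeometry.Motives
open Literature.AlgebraicGeometry.HodgeTheory Literature.AlgebraicTopology.SingularHomology
open Literature.AlgebraicGeometry.Motives.HodgeStructure Literature.AlgebraicGeometry.Hyperkaehler
open Literature.AlgebraicGeometry.Surfaces
open Summit.HodgeConjecture.HodgeConjecture.Theorems.NikulinTwinTransport
open Summit.HodgeConjecture.HodgeConjecture.Theorems.MarkmanPartnerTransport.BBFPositivity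
open Summit.HodgeConjecture.HodgeConjecture.Theorems.MarkmanPartnerTransport.PartnerLattice
open Summit.HodgeConjecture.HodgeConjecture.Theorems.MarkmanPartnerTransport.KugaSatakeSelf

variable {X : SchemeOver ℂ} {φ : complexBetti X 2 ≃ₗ[ℂ] (K3HilbertIndex → ℂ)} {P : complexBetti X (2 * 4)}
  {z : K3HilbertIndex → ℂ}

/-- `MarkedK3Sq[X, φ, P, z]`: VERBATIM the `let MarkedK3Sq := …` binder of the route declarations of
MarkmanPartnerTransport (clauses (m1)–(m6)). Local notation only. -/
local notation3 (prettyPrint := false) "MarkedK3Sq[" X ", " φ ", " P ", " z "]" =>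
  (((IsIntegralClass P ∧ ∀ Q : complexBetti X (2 * 4), IsIntegralClass Q → ∃ n : ℤ, Q = n • P) ∧
    (∀ c : complexBetti X 2, IsIntegralClass c ↔ ∃ v : K3HilbertIndex → ℤ, φ c = fun i => (v i : ℂ)) ∧
    (∀ a : complexBetti X 2, cupPowTwo a 4 = ((3 : ℂ) * (k3HilbertForm 2 (φ a) (φ a)) ^ 2) • P) ∧
    (IsOfHodgeType 4 X 2 2 0 (LinearEquiv.symm φ z) ∧
      ∀ τ : complexBetti X 2, IsOfHodgeType 4 X 2 2 0 τ → ∃ t : ℂ, τ = t • LinearEquiv.symm φ z) ∧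
    (∀ c : complexBetti X 2, IsOfHodgeType 4 X 2 1 1 c ↔
      (k3HilbertForm 2 (φ c) z = 0 ∧ k3HilbertForm 2 (φ c) (star z) = 0)) ∧
    (k3HilbertForm 2 z z = 0 ∧ 0 < (k3HilbertForm 2 (star z) z).re)))

/-- `H²_B[hX]`: the weight-two `ℚ`-Hodge structure on `H²(X(ℂ); ℚ)` of the real Hodge model of the fourfold
`X` (`hX : IsSmoothProjective (2 * 2) X`). Local notation only. -/
local notation3 "H²_B[" hX "]" =>
  bettiTwoHodgeStructureOfModel hX (BettiUniverse.realHodgeModel exists_isReal_hodgeModel_holds hX)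
    (BettiUniverse.realHodgeModel_isHodgeSymmetric exists_isReal_hodgeModel_holds hX)

/-- `Θ : ℂ ⊗_ℚ H²(X(ℂ); ℚ) → H²(X(ℂ); ℂ)`. -/
local notation3 "Θ[" X "]" => ofRatClassBaseChange (Motives.ComplexPoints X) (2 * 1)

/-- `ι : H²(X(ℂ); ℚ) → H²(X(ℂ); ℂ)`, the rational lattice. -/
local notation3 "ι[" X "]" => ofRatClass (Motives.ComplexPoints X) (2 * 1)


/-! ### §1 Hodge descent of a rational, type-preserving self-map of `H²(X(ℂ); ℂ)` -/

/-- **A rational, Hodge-type-preserving `θ : H²(X(ℂ); ℂ) → H²(X(ℂ); ℂ)` of the fourfold `X` descends to a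
morphism of `ℚ`-Hodge structures `Θ_B : H²_B(X) → H²_B(X)`** (`ι ∘ Θ_B = θ ∘ ι`): the rational descent
(`KugaSatakeSelf.exists_ratLinear_ofRatClass_eq`) preserves the Hodge filtration `F^p = ⊕_{a ≥ p} Θ⁻¹H^{a,2-a}`
(`HodgeModel.ratF_eq_iSup`) because `θ` preserves each type (types read in the real model by
`hodgePQ_independent_of_hodgeModel_holds`). [cite: VoisinHodgeI2002, §7.3.1 and §7.1.1] -/
theorem exists_hom_ofRatClass_eqHK (hX : IsSmoothProjective (2 * 2) X)
    (θ : complexBetti X 2 →ₗ[ℂ] complexBetti X 2) (h1 : ∀ y, IsRationalClass y → IsRationalClass (θ y))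
    (h2 : ∀ (i j : ℕ) y, IsOfHodgeType 4 X 2 i j y → IsOfHodgeType 4 X 2 i j (θ y)) :
    ∃ Θ : Hom (H²_B[hX]) (H²_B[hX]), ∀ v, ι[X] (Θ.toLinearMap v) = θ (ι[X] v) := by
  obtain ⟨Ψ, hΨ⟩ := exists_ratLinear_ofRatClass_eq (S := X) θ h1
  set A := BettiUniverse.realHodgeModel exists_isReal_hodgeModel_holds hX with hA
  have hI := hodgePQ_independent_of_hodgeModel_holds
  refine ⟨{ toLinearMap := Ψ, map_F_le := fun r => ?_ }, hΨ⟩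
  rintro _ ⟨x, hx, rfl⟩
  have hF : (H²_B[hX]).F r = A.ratF hX (2 * 1) r := rfl
  rw [SetLike.mem_coe, hF, HodgeModel.ratF_eq_iSup] at hx
  rw [hF, HodgeModel.ratF_eq_iSup]
  induction hx using Submodule.iSup_induction' with
  | mem pq x hx =>
    by_cases hr : r ≤ (pq.1.1 : ℤ)
    · rw [iSup_pos hr, HodgeModel.mem_ratPiece_iff, HodgeModel.complexification_apply] at hx
      have hty : IsOfHodgeType 4 X 2 pq.1.1 pq.1.2 (Θ[X] x) := ⟨A, hx⟩
      have hty' := h2 _ _ _ hty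
      rw [← ofRatClassBaseChange_baseChange_eq (S := X) hΨ] at hty'
      obtain ⟨B', hB'⟩ := hty'
      have h3 := hI (2 * 2) X hX B' A (2 * 1) pq.1.1 pq.1.2 _ hB'
      refine Submodule.mem_iSup_of_mem pq (Submodule.mem_iSup_of_mem hr ?_)
      rw [HodgeModel.mem_ratPiece_iff, HodgeModel.complexification_apply]
      exact h3
    · rw [iSup_neg hr, Submodule.mem_bot] at hx
      rw [hx, map_zero]
      exact Submodule.zero_mem _
  | zero => rw [map_zero]; exact Submodule.zero_mem _
  | add x y _ _ hx hy => rw [map_add]; exact Submodule.add_mem _ hx hy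

/-! ### §2 Rational Hodge classes versus `N¹(X)`; `q`-transcendence -/

/-- `Hdg¹ ⊂ H²_B(X)` = the rational classes of type `(1,1)` (real model). [cite: VoisinHodgeI2002, §7.1.1 and §11.3.1] -/
theorem mem_hodgeClassesHK_iff (hX : IsSmoothProjective (2 * 2) X) (v : bettiCohomology X (2 * 1)) :
    v ∈ (H²_B[hX]).hodgeClasses 1 ↔ IsOfHodgeType 4 X (2 * 1) 1 1 (ι[X] v) := by
  rw [bettiTwoHodgeStructureOfModel, cast_hodgeClasses]
  exact (BettiUniverse.realHodgeModel exists_isReal_hodgeModel_holds hX).mem_hodgeClasses_iff_isOfHodgeType hX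
    hodgePQ_independent_of_hodgeModel_holds _ 1 v

/-- **`Θ(Hdg¹_ℂ) = N¹(X)`**: the complex span of the rational `(1,1)`-classes is the space of algebraic divisor
classes (Lefschetz `(1,1)`, `lefschetzOneOne_rational_holds`, and `N¹ = span of rational algebraic classes`,
`supportedClasses_eq_span_isRationalClass`). [cite: VoisinHodgeI2002, Thm. 11.30] -/
theorem map_hodgeClassesHK_baseChange_eq (hX : IsSmoothProjective (2 * 2) X) :
    (((H²_B[hX]).hodgeClasses 1).baseChange ℂ).map (Θ[X]) = algebraicClasses X 1 := by
  apply le_antisymm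
  · rintro _ ⟨x, hx, rfl⟩
    obtain ⟨u, rfl⟩ := hx
    induction u using TensorProduct.induction_on with
    | zero => rw [map_zero, map_zero]; exact Submodule.zero_mem _
    | tmul c h =>
      rw [LinearMap.baseChange_tmul, Submodule.subtype_apply, ofRatClassBaseChange_tmul]
      exact Submodule.smul_mem _ c
        (lefschetzOneOne_rational_holds hX _ (isRationalClass_ofRatClass _) ((mem_hodgeClassesHK_iff hX _).1 h.2))
    | add u₁ u₂ h₁ h₂ => rw [map_add, map_add]; exact Submodule.add_mem _ h₁ h₂
  · change supportedClasses X (2 * 1) 1 ≤ _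
    rw [supportedClasses_eq_span_isRationalClass hX (2 * 1) 1]
    refine Submodule.span_le.2 ?_
    rintro c ⟨hcQ, hcN⟩
    obtain ⟨a, rfl⟩ := (isRationalClass_iff_mem_range_ofRatClass c).1 hcQ
    have ha : a ∈ (H²_B[hX]).hodgeClasses 1 :=
      (mem_hodgeClassesHK_iff hX a).2 (isOfHodgeType_of_mem_algebraicClasses_of_isSmoothProjective hX 1 hcN)
    exact ⟨(1 : ℂ) ⊗ₜ a, Submodule.tmul_mem_baseChange_of_mem 1 ha, by rw [ofRatClassBaseChange_tmul, one_smul]⟩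

/-- A rational Hodge class complexifies to an algebraic divisor class. [cite: VoisinHodgeI2002, Thm. 11.30] -/
theorem ofRatClass_mem_algebraicClasses_of_mem_hodgeClassesHK (hX : IsSmoothProjective (2 * 2) X)
    {h : bettiCohomology X (2 * 1)} (hh : h ∈ (H²_B[hX]).hodgeClasses 1) : ι[X] h ∈ algebraicClasses X 1 := by
  rw [← map_hodgeClassesHK_baseChange_eq hX]
  exact ⟨(1 : ℂ) ⊗ₜ h, Submodule.tmul_mem_baseChange_of_mem 1 hh, by rw [ofRatClassBaseChange_tmul, one_smul]⟩

/-- **`q`-transcendence is tested on the rational Hodge classes**: `y ⊥_q N¹(X)` iff `y ⊥_q ι h` for every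
`h ∈ Hdg¹` (`N¹(X) = Θ(Hdg¹_ℂ)`). [cite: Huybrechts2016K3, Ch. 3 Lemma 3.1] [cite: VoisinHodgeI2002, Thm. 11.30] -/
theorem bbfTransc_iff_hodgeClasses (hX : IsSmoothProjective (2 * 2) X) (y : complexBetti X 2) :
    (∀ e : complexBetti X 2, e ∈ algebraicClasses X 1 → k3HilbertForm 2 (φ y) (φ e) = 0) ↔
      ∀ h ∈ (H²_B[hX]).hodgeClasses 1, k3HilbertForm 2 (φ y) (φ (ι[X] h)) = 0 := by
  refine ⟨fun H h hh => H _ (ofRatClass_mem_algebraicClasses_of_mem_hodgeClassesHK hX hh), fun H e he => ?_⟩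
  rw [← map_hodgeClassesHK_baseChange_eq hX] at he
  obtain ⟨u, hu, rfl⟩ := he
  obtain ⟨u', rfl⟩ := hu
  induction u' using TensorProduct.induction_on with
  | zero => rw [map_zero, map_zero, map_zero, bbf_zero_right]
  | tmul a h =>
    rw [LinearMap.baseChange_tmul, Submodule.subtype_apply, ofRatClassBaseChange_tmul, map_smul, bbf_smul_right, H _ h.2,
      mul_zero]
  | add x₁ x₂ hx₁ hx₂ => rw [map_add, map_add, map_add, bbf_add_right, hx₁, hx₂, add_zero]

/-! ### §3 Restriction to the transcendental part -/

/-- **A Hodge endomorphism of `T(X)_ℚ` from `θ`.** For a sub-Hodge structure `T ⊆ H²_B(X)` whose vectors are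
exactly the classes `q`-orthogonal to the rational Hodge classes (the transcendental part `Hdg¹^{⊥ q_B}` of
`…K3Sq2BettiTwoHodgeStructure`) and `θ` rational, type-preserving with `q`-transcendental image, the descent
`Θ_B` maps `T` into itself and restricts to `θ_T : Hom T T` with `(θ_T t) ⊗ 1 = θ(t ⊗ 1)`.
[cite: VoisinHodgeI2002, §7.3.1] [cite: Huybrechts2016K3, Ch. 3 Lemma 3.1] -/
theorem exists_hom_transcendentalHK (hX : IsSmoothProjective (2 * 2) X) (T : SubHodgeStructure (H²_B[hX]))
    (hT : ∀ x : bettiCohomology X (2 * 1), x ∈ T.toSubmodule ↔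
      ∀ h ∈ (H²_B[hX]).hodgeClasses 1, k3HilbertForm 2 (φ (ι[X] x)) (φ (ι[X] h)) = 0)
    (θ : complexBetti X 2 →ₗ[ℂ] complexBetti X 2) (h1 : ∀ y, IsRationalClass y → IsRationalClass (θ y))
    (h2 : ∀ (i j : ℕ) y, IsOfHodgeType 4 X 2 i j y → IsOfHodgeType 4 X 2 i j (θ y))
    (h4 : ∀ y : complexBetti X 2, ∀ e : complexBetti X 2, e ∈ algebraicClasses X 1 →
      k3HilbertForm 2 (φ (θ y)) (φ e) = 0) :
    ∃ θT : Hom T.toHodgeStructure T.toHodgeStructure,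
      ∀ t : T.toSubmodule, ι[X] ((θT.toLinearMap t : T.toSubmodule) : bettiCohomology X (2 * 1)) =
        θ (ι[X] (t : bettiCohomology X (2 * 1))) := by
  obtain ⟨Ψ, hΨ⟩ := exists_hom_ofRatClass_eqHK hX θ h1 h2
  have hmem : ∀ t : T.toSubmodule, (Ψ.comp T.subtypeHom).toLinearMap t ∈ T.toSubmodule := by
    intro t
    change Ψ.toLinearMap (t : bettiCohomology X (2 * 1)) ∈ T.toSubmodule
    rw [hT]
    intro h hh
    rw [hΨ]
    exact (bbfTransc_iff_hodgeClasses hX _).1 (h4 _) h hh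
  exact ⟨(Ψ.comp T.subtypeHom).codRestrict T hmem, fun t => hΨ _⟩

section Restriction

variable {hX : IsSmoothProjective (2 * 2) X} {T : SubHodgeStructure (H²_B[hX])}
  {θ : complexBetti X 2 →ₗ[ℂ] complexBetti X 2} {θT : Hom T.toHodgeStructure T.toHodgeStructure}

/-- **`θ_T² = d`** when `θ² = d` on the `q`-transcendental classes. [cite: Varesco2023, §4 (proof of Thm. 4.5)] -/
theorem hom_transcendentalHK_sq
    (hT : ∀ x : bettiCohomology X (2 * 1), x ∈ T.toSubmodule ↔
      ∀ h ∈ (H²_B[hX]).hodgeClasses 1, k3HilbertForm 2 (φ (ι[X] x)) (φ (ι[X] h)) = 0)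
    (hθT : ∀ t : T.toSubmodule, ι[X] ((θT.toLinearMap t : T.toSubmodule) : bettiCohomology X (2 * 1)) =
      θ (ι[X] (t : bettiCohomology X (2 * 1))))
    {d : ℚ} (hθθ : ∀ y : complexBetti X 2,
      (∀ e : complexBetti X 2, e ∈ algebraicClasses X 1 → k3HilbertForm 2 (φ y) (φ e) = 0) → θ (θ y) = (d : ℂ) • y)
    (t : T.toSubmodule) : θT.toLinearMap (θT.toLinearMap t) = d • t := by
  apply Subtype.ext
  apply ofRatClass_injective (Y := Motives.ComplexPoints X) (2 * 1)
  have ht : ∀ e : complexBetti X 2, e ∈ algebraicClasses X 1 →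
      k3HilbertForm 2 (φ (ι[X] (t : bettiCohomology X (2 * 1)))) (φ e) = 0 :=
    (bbfTransc_iff_hodgeClasses hX _).2 ((hT _).1 t.2)
  rw [hθT, hθT, hθθ _ ht, Submodule.coe_smul, ofRatClass_smul]

/-- **`θ_T` is `q`-self-adjoint** when `θ` is: `q(θ_T a ⊗ 1, b ⊗ 1) = q(a ⊗ 1, θ_T b ⊗ 1)`. [folklore] -/
theorem bbf_hom_transcendentalHK
    (hθT : ∀ t : T.toSubmodule, ι[X] ((θT.toLinearMap t : T.toSubmodule) : bettiCohomology X (2 * 1)) =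
      θ (ι[X] (t : bettiCohomology X (2 * 1))))
    (h5 : ∀ y w : complexBetti X 2, k3HilbertForm 2 (φ (θ y)) (φ w) = k3HilbertForm 2 (φ y) (φ (θ w)))
    (a b : T.toSubmodule) :
    k3HilbertForm 2 (φ (ι[X] ((θT.toLinearMap a : T.toSubmodule) : bettiCohomology X (2 * 1))))
        (φ (ι[X] (b : bettiCohomology X (2 * 1)))) =
      k3HilbertForm 2 (φ (ι[X] (a : bettiCohomology X (2 * 1))))
        (φ (ι[X] ((θT.toLinearMap b : T.toSubmodule) : bettiCohomology X (2 * 1)))) := by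
  rw [hθT, hθT, h5]

end Restriction

end Summit.HodgeConjecture.HodgeConjecture.Theorems.MarkmanPartnerTransport.KugaSatakeHK

/-! ### §4 The second presentation `(T, d·P, j ∘ g)` — any `2n`-dimensional `X` -/

namespace Summit.HodgeConjecture.HodgeConjecture.Theorems.MarkmanPartnerTransport.KugaSatakeHK

open scoped TensorProduct
open CategoryTheory MonoidalCategory Literature.AlgebraicGeometry Literature.AlgebraicGeometry.Motives
open Literature.AlgebraicGeometry.HodgeTheory Literature.AlgebraicTopology.SingularHomology
open Literature.AlgebraicGeometry.Motives.HodgeStructure Literature.AlgebraicGeometry.Hyperkaehler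
open Summit.HodgeConjecture.HodgeConjecture.Theorems.MarkmanPartnerTransport.KugaSatakeSelf

/-- **The second presentation of the transcendental part of a hyperkähler-type `X`.** Let `(T, H, P, j)`
present the transcendental part of the `2n`-dimensional `X` for the Fujiki form `b` (`IsTranscendentalPartHK`:
`j` injective onto `Hdg¹^{⊥ b}`, `P = b ∘ (j × j)`) and let `g : Hom H H` be `b`-self-adjoint (through `j`) with
`g² = d`, `d > 0`. Then `(T, H, d·P, j ∘ g)` presents it as well: `j g` is injective (`g² = d ≠ 0`), has the
same image (`t = g(d⁻¹ g t)`), and `b(jg t, jg t') = b(j t, j g² t') = d · P(t, t')`. The presentation at which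
the Kuga–Satake predicate is instantiated a second time. [cite: Varesco2023, §4 (proof of Thm. 4.5)]
[cite: Floccari2024, §5.1] [cite: vanGeemen2000KugaSatakeHC, §10.1–10.2] -/
theorem isTranscendentalPartHK_smul_comp {n : ℕ} {X : SchemeOver ℂ} (hX : IsSmoothProjective (2 * n) X)
    {M : HodgeModel (2 * n) X} {hM : M.IsHodgeSymmetric} {b : complexBetti X 2 →ₗ[ℂ] complexBetti X 2 →ₗ[ℂ] ℂ}
    {T : Type} [AddCommGroup T] [Module ℚ T] {H : HodgeStructure T 2} {P : H.Polarization}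
    {j : H.Hom (bettiTwoHodgeStructureOfModel hX M hM)} (hj : IsTranscendentalPartHK hX M hM b H P j)
    (g : Hom H H) {d : ℚ} (hd : 0 < d) (hgg : ∀ t, g.toLinearMap (g.toLinearMap t) = d • t)
    (hga : ∀ a c : T,
      b (ofRatClass (Motives.ComplexPoints X) (2 * 1) (j.toLinearMap (g.toLinearMap a)))
          (ofRatClass (Motives.ComplexPoints X) (2 * 1) (j.toLinearMap c)) =
        b (ofRatClass (Motives.ComplexPoints X) (2 * 1) (j.toLinearMap a))
          (ofRatClass (Motives.ComplexPoints X) (2 * 1) (j.toLinearMap (g.toLinearMap c)))) :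
    IsTranscendentalPartHK hX M hM b H (P.smul d hd) (j.comp g) := by
  obtain ⟨hinj, hrange, hform⟩ := hj
  have hd0 : d ≠ 0 := hd.ne'
  have hginj : Function.Injective g.toLinearMap := by
    intro a c h
    have h' := congrArg g.toLinearMap h
    rw [hgg, hgg] at h'
    exact smul_right_injective T hd0 h'
  have hcomp : (j.comp g).toLinearMap = j.toLinearMap ∘ₗ g.toLinearMap := rfl
  have hrg : LinearMap.range (j.comp g).toLinearMap = LinearMap.range j.toLinearMap := by
    rw [hcomp]
    refine le_antisymm ?_ ?_
    · rintro _ ⟨t, rfl⟩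
      exact ⟨g.toLinearMap t, rfl⟩
    · rintro _ ⟨t, rfl⟩
      refine ⟨d⁻¹ • g.toLinearMap t, ?_⟩
      change j.toLinearMap (g.toLinearMap (d⁻¹ • g.toLinearMap t)) = j.toLinearMap t
      rw [map_smul, hgg, smul_smul, inv_mul_cancel₀ hd0, one_smul]
  refine ⟨hinj.comp hginj, fun x => ?_, fun t t' => ?_⟩
  · rw [hrg]
    exact hrange x
  · change (((d • P.form) t t' : ℚ) : ℂ) = b (ofRatClass _ (2 * 1) (j.toLinearMap (g.toLinearMap t)))
      (ofRatClass _ (2 * 1) (j.toLinearMap (g.toLinearMap t')))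
    rw [LinearMap.smul_apply, LinearMap.smul_apply, smul_eq_mul, Rat.cast_mul, hform, hga, hgg, map_smul,
      ofRatClass_smul, map_smul, smul_eq_mul]

/-! ### §5 The two Kuga–Satake correspondences of a self-map, GRANTED `IsKSCorrespondenceAlgebraicHK` -/

/-- **THE TWO ALGEBRAIC CORRESPONDENCES OF A SELF-SIMILITUDE OF A HYPERKÄHLER-TYPE `X`, GRANTED KUGA–SATAKE.**
Let `X` be smooth projective of dimension `2n` whose Kuga–Satake correspondence is algebraic
(`IsKSCorrespondenceAlgebraicHK n`, HYPOTHESIS — open in print), `(T, H, P, j)` a presentation of its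
transcendental part for the Fujiki form `b` with `H` of K3 type, and `g : Hom H H` with `(T, H, d·P, j ∘ g)` a
presentation too (`isTranscendentalPartHK_smul_comp`). Then for some complex abelian variety `A` (a Kuga–Satake
variety of `(T, H, P)`: vG §5–8 and Riemann's theorem, `exists_isKugaSatakeVarietyBetti_of_isOfK3Type'`), some
INJECTIVE `μ : T → H²((A × A)(ℂ); ℚ)` and two maps `O₁, O₂ : H²(X(ℂ); ℂ) → H²((A × A)(ℂ); ℂ)` INDUCED BY ALGEBRAIC
CYCLES on `(A × A) × X`: `O₁(j t ⊗ 1) = μ t ⊗ 1 = O₂(j (g t) ⊗ 1)` — the predicate instantiated at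
`(T, H, P, j; e₁, e₂, κ_C; A, B, θ)` and at `(T, H, d·P, j ∘ g; d⁻¹e₁, e₂, (φ ⊗ φ)κ_C; A, B, φθ)`, whose class
maps coincide (gen 14's transport along `C⁺(dQ) ≅ C⁺(Q)`). CONDITIONAL on the Kuga–Satake hypothesis.
[cite: Varesco2023, §4 (proof of Thm. 4.5) and Prop. 3.1] [cite: Floccari2024, §5.1]
[cite: vanGeemen2000KugaSatakeHC, §6.3 and §10.2] -/
theorem exists_two_correspondences_of_kugaSatakeHK {n : ℕ} {X : SchemeOver ℂ} (hX : IsSmoothProjective (2 * n) X)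
    (hKS : IsKSCorrespondenceAlgebraicHK n hX) {M : HodgeModel (2 * n) X} {hM : M.IsHodgeSymmetric}
    {b : complexBetti X 2 →ₗ[ℂ] complexBetti X 2 →ₗ[ℂ] ℂ} (hb : IsFujikiForm n X b)
    {T : Type} [AddCommGroup T] [Module ℚ T] [Module.Finite ℚ T] {H : HodgeStructure T 2} {P : H.Polarization}
    {j : H.Hom (bettiTwoHodgeStructureOfModel hX M hM)} (hj : IsTranscendentalPartHK hX M hM b H P j)
    (hK3 : H.IsOfK3Type) (g : Hom H H) {d : ℚ} (hd : 0 < d)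
    (hjg : IsTranscendentalPartHK hX M hM b H (P.smul d hd) (j.comp g)) :
    ∃ (A : AbelianVariety ℂ) (μ : T →ₗ[ℚ] bettiCohomology (A.X ⊗ A.X) 2)
      (O₁ O₂ : complexBetti X (2 * 1) →ₗ[ℂ] complexBetti (A.X ⊗ A.X) 2),
      Function.Injective μ ∧
      IsAlgebraicCorrespondence (A.dim + A.dim) (2 * n) (A.X ⊗ A.X) X O₁ ∧
      IsAlgebraicCorrespondence (A.dim + A.dim) (2 * n) (A.X ⊗ A.X) X O₂ ∧
      (∀ t : T, O₁ (ofRatClass (Motives.ComplexPoints X) (2 * 1) (j.toLinearMap t)) =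
        ofRatClass (Motives.ComplexPoints (A.X ⊗ A.X)) 2 (μ t)) ∧
      (∀ t : T, O₂ (ofRatClass (Motives.ComplexPoints X) (2 * 1) (j.toLinearMap (g.toLinearMap t))) =
        ofRatClass (Motives.ComplexPoints (A.X ⊗ A.X)) 2 (μ t)) := by
  have hT : H.hodgeNumber 2 0 = 1 := hK3.1
  -- van Geemen's data for `(T, H, P)` and ONE Kuga–Satake variety
  obtain ⟨e₁, e₂, h12, h1, h2⟩ := P.exists_orthogonal_pair_form_self_neg H hK3
  obtain ⟨κ, hκ⟩ := exists_isTensorEmbedding P hK3 h12 h1 h2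
  obtain ⟨A, B, hB, θ, hθ⟩ := Literature.AlgebraicGeometry.Surfaces.exists_isKugaSatakeVarietyBetti_of_isOfK3Type' H P hK3
  -- first instantiation
  obtain ⟨O₁, hO₁, hO₁j⟩ := hKS b hb M hM T H P hT j hj e₁ e₂ h12 h1 h2 κ hκ A B hB θ hθ
  -- second instantiation, at the transported data
  obtain ⟨h12', h1', h2'⟩ := smul_pair_conditions P hd h12 h1 h2
  obtain ⟨O₂, hO₂, hO₂j⟩ := hKS b hb M hM T H (P.smul d hd) hT (j.comp g) hjg (d⁻¹ • e₁) e₂ h12' h1' h2' _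
    (isTensorEmbedding_transport P hd hκ) A B hB _ (isKugaSatakeVarietyBetti_transport P hd hT hθ)
  refine ⟨A, kugaSatakeClassMapBetti H P θ κ, O₁, O₂,
    kugaSatakeClassMapBetti_injective P A θ (isTensorEmbedding_injective P h1.ne hκ), hO₁, hO₂, hO₁j,
    fun t => ?_⟩
  rw [← kugaSatakeClassMapBetti_transport P hd θ κ t]
  exact hO₂j t

end Summit.HodgeConjecture.HodgeConjecture.Theorems.MarkmanPartnerTransport.KugaSatakeHK

end
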